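import Literature.Probability.Percolation.StarWinding
import HarnessLib

/-!
# The eye lemma for band-avoiding semicircuits, and for `∗`-escape walks

Topic `Probability/Percolation`. `StarWinding.lean` proved the eye lemma for an upper and a lower
`∗`-semicircuit. In Georgii–Higuchi 2000, Lemma 5.5, the two `≤∗`paths joining `x ∈ ℓ_left` to
`y ∈ ℓ_right` "above" resp. "below" the square `Δ` are obtained from the pinning lemma and need
not stay in a half-plane; what they do avoid is a band: the upper path avoids
`{c₁ ≤ z₁ ≤ c₂, z₂ ≤ m}` (the square and everything below it), the lower path avoids
`{c₁ ≤ z₁ ≤ c₂, z₂ ≥ -m}`. We prove the eye lemma in this generality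
(`exists_mem_support_of_bandSemicircuits`), by the same winding-number computation with
different telescoping potentials, and derive the version for `∗`-escape walks
(`exists_touch_of_bandSemicircuits`: a `∗`-walk from the window to far away has a vertex equal
or lattice-adjacent to a vertex of one of the semicircuits), by refining diagonal steps.

## References

* H.-O. Georgii, Y. Higuchi, J. Math. Phys. 41 (2000), proofs of Lemma 5.2 and Lemma 5.5
  [GeorgiiHiguchi2000].
* H. Kesten, *Percolation theory for mathematicians*, Birkhäuser 1982, §2.2 [Kesten1982].
-/

noncomputable section

open SimpleGraph
open Literature.Probability.LatticeModels (Site zdGraph zdStarGraph zdGraph_adj_iff zdStarGraph_adj box mem_box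
  zdGraph_le_zdStarGraph)

namespace Literature.Probability.Percolation

/-! ### Telescoping computations for band-avoiding walks -/

section Telescope

variable {aL bR c₁ c₂ : ℤ} {m : ℕ} {xL xR : Site 2}

/-- Generic telescoping step: all the dart case analyses below have this shape. [folklore] -/
theorem starWinding_telescope_of {p : zdStarGraph.Walk xL xR} {u : Site 2} (g : Site 2 → ℤ)
    (h : ∀ x y : Site 2, x ∈ p.support → y ∈ p.support → zdStarGraph.Adj x y → starStepWinding u x y = g y - g x) :
    starWinding p u = g xR - g xL :=
  starWinding_eq_of_telescope p u g fun d hd =>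
    h d.fst d.snd (Walk.dart_fst_mem_support_of_mem_darts p hd) (Walk.dart_snd_mem_support_of_mem_darts p hd) d.adj

/-- Upper path (avoiding the lower band), base point on the axis inside the window: winding `-1`. [folklore] -/
theorem starWinding_upperBand_axis (hac : aL < c₁) (hcc : c₁ ≤ c₂) (hcb : c₂ < bR)
    (hxL0 : xL 0 = aL) (hxR0 : xR 0 = bR) (hxR1 : xR 1 = 0)
    (α : zdStarGraph.Walk xL xR) (hα : ∀ z ∈ α.support, ¬ (c₁ ≤ z 0 ∧ z 0 ≤ c₂ ∧ z 1 ≤ m))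
    {b : Site 2} (hb : c₁ ≤ b 0 ∧ b 0 ≤ c₂) (hb1 : b 1 = 0) : starWinding α b = -1 := by
  rw [starWinding_telescope_of (fun z => if c₂ + 1 ≤ z 0 ∧ z 1 ≤ 0 then (-1 : ℤ) else 0)]
  · rw [if_pos ⟨by omega, by omega⟩, if_neg (by omega)]; ring
  · intro x y hx hy hadj
    have hx' := hα x hx; have hy' := hα y hy
    rw [zdStarGraph_adj] at hadj
    have h0 := hadj.2 0; have h1 := hadj.2 1
    rw [abs_le] at h0 h1
    unfold starStepWinding starUpStep
    split_ifs <;> omega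

/-- Lower path (avoiding the upper band), base point on the axis inside the window: winding `0`. [folklore] -/
theorem starWinding_lowerBand_axis (hcc : c₁ ≤ c₂)
    (hxL1 : xL 1 = 0) (hxR1 : xR 1 = 0)
    (α' : zdStarGraph.Walk xL xR) (hα' : ∀ z ∈ α'.support, ¬ (c₁ ≤ z 0 ∧ z 0 ≤ c₂ ∧ -(m : ℤ) ≤ z 1))
    {b : Site 2} (hb : c₁ ≤ b 0 ∧ b 0 ≤ c₂) (hb1 : b 1 = 0) : starWinding α' b = 0 := by
  rw [starWinding_telescope_of (fun z => if c₂ + 1 ≤ z 0 ∧ 1 ≤ z 1 then (1 : ℤ) else 0)]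
  · rw [if_neg (by omega), if_neg (by omega)]; ring
  · intro x y hx hy hadj
    have hx' := hα' x hx; have hy' := hα' y hy
    rw [zdStarGraph_adj] at hadj
    have h0 := hadj.2 0; have h1 := hadj.2 1
    rw [abs_le] at h0 h1
    unfold starStepWinding starUpStep
    split_ifs <;> omega

/-- Upper path, base point on the row `-1` inside the window: winding `0`. [folklore] -/
theorem starWinding_upperBand_below (hcc : c₁ ≤ c₂)
    (hxL1 : xL 1 = 0) (hxR1 : xR 1 = 0)
    (α : zdStarGraph.Walk xL xR) (hα : ∀ z ∈ α.support, ¬ (c₁ ≤ z 0 ∧ z 0 ≤ c₂ ∧ z 1 ≤ m))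
    {b : Site 2} (hb : c₁ ≤ b 0 ∧ b 0 ≤ c₂) (hb1 : b 1 = -1) : starWinding α b = 0 := by
  rw [starWinding_telescope_of (fun z => if c₂ + 1 ≤ z 0 ∧ z 1 ≤ -1 then (-1 : ℤ) else 0)]
  · rw [if_neg (by omega), if_neg (by omega)]; ring
  · intro x y hx hy hadj
    have hx' := hα x hx; have hy' := hα y hy
    rw [zdStarGraph_adj] at hadj
    have h0 := hadj.2 0; have h1 := hadj.2 1
    rw [abs_le] at h0 h1
    unfold starStepWinding starUpStep
    split_ifs <;> omega

/-- Lower path, base point on the row `-1` inside the window (`m ≥ 1`): winding `+1`. [folklore] -/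
theorem starWinding_lowerBand_below (hac : aL < c₁) (hcc : c₁ ≤ c₂) (hcb : c₂ < bR) (hm : 1 ≤ m)
    (hxL0 : xL 0 = aL) (hxR0 : xR 0 = bR) (hxR1 : xR 1 = 0)
    (α' : zdStarGraph.Walk xL xR) (hα' : ∀ z ∈ α'.support, ¬ (c₁ ≤ z 0 ∧ z 0 ≤ c₂ ∧ -(m : ℤ) ≤ z 1))
    {b : Site 2} (hb : c₁ ≤ b 0 ∧ b 0 ≤ c₂) (hb1 : b 1 = -1) : starWinding α' b = 1 := by
  rw [starWinding_telescope_of (fun z => if c₂ + 1 ≤ z 0 ∧ 0 ≤ z 1 then (1 : ℤ) else 0)]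
  · rw [if_pos ⟨by omega, by omega⟩, if_neg (by omega)]; ring
  · intro x y hx hy hadj
    have hx' := hα' x hx; have hy' := hα' y hy
    rw [zdStarGraph_adj] at hadj
    have h0 := hadj.2 0; have h1 := hadj.2 1
    rw [abs_le] at h0 h1
    unfold starStepWinding starUpStep
    split_ifs <;> omega

end Telescope

/-! ### The eye lemma for band-avoiding semicircuits -/

/-- **The eye lemma, band form**: `α` from `(a, 0)` to `(b, 0)` avoiding the lower band
`{c₁ ≤ z₁ ≤ c₂, z₂ ≤ m}`, `α'` between the same points avoiding the upper band
`{c₁ ≤ z₁ ≤ c₂, z₂ ≥ -m}`, `a < c₁ ≤ c₂ < b`: every lattice walk from the window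
`[c₁, c₂] × [-m, m]` to a site outside a box containing `α, α'` meets `α` or `α'`. [cite: GeorgiiHiguchi2000, Lemma 5.5 (proof)] -/
theorem exists_mem_support_of_bandSemicircuits {aL bR c₁ c₂ : ℤ} {m : ℕ} (hac : aL < c₁) (hcb : c₂ < bR)
    {xL xR : Site 2} (hxL0 : xL 0 = aL) (hxL1 : xL 1 = 0) (hxR0 : xR 0 = bR) (hxR1 : xR 1 = 0)
    (α : zdStarGraph.Walk xL xR) (hα : ∀ z ∈ α.support, ¬ (c₁ ≤ z 0 ∧ z 0 ≤ c₂ ∧ z 1 ≤ m))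
    (α' : zdStarGraph.Walk xL xR) (hα' : ∀ z ∈ α'.support, ¬ (c₁ ≤ z 0 ∧ z 0 ≤ c₂ ∧ -(m : ℤ) ≤ z 1))
    {H : ℕ} (hH : ∀ z ∈ α.support, z ∈ box 2 H) (hH' : ∀ z ∈ α'.support, z ∈ box 2 H)
    {u w : Site 2} (hu : c₁ ≤ u 0 ∧ u 0 ≤ c₂ ∧ -(m : ℤ) ≤ u 1 ∧ u 1 ≤ m) (hw : w ∉ box 2 H)
    (β : (zdGraph 2).Walk u w) : ∃ z ∈ β.support, z ∈ α.support ∨ z ∈ α'.support := by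
  have hcc : c₁ ≤ c₂ := hu.1.trans hu.2.1
  by_contra hdis
  push Not at hdis
  set C := α.append α'.reverse with hC
  have hCsupp : ∀ z, z ∈ C.support ↔ z ∈ α.support ∨ z ∈ α'.support := fun z => by
    rw [hC, Walk.mem_support_append_iff, Walk.support_reverse, List.mem_reverse]
  have hw0 : starWinding C w = 0 :=
    starWinding_eq_zero_of_not_mem_box C (fun z hz => by
      rcases (hCsupp z).1 hz with h | h
      · exact hH z h
      · exact hH' z h) hw
  have hconst : starWinding C u = starWinding C w :=
    starWinding_eq_of_latticeWalk C β (fun z hz h => by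
      rcases (hCsupp z).1 h with h' | h'
      · exact (hdis z hz).1 h'
      · exact (hdis z hz).2 h') (fun _ _ _ _ _ => Iff.rfl)
  have hCu : starWinding C u = -1 := by
    rw [hC, starWinding_append, starWinding_reverse]
    rcases le_or_gt 0 (u 1) with hu0 | hu0
    · obtain ⟨k, hk⟩ : ∃ k : ℕ, u 1 = k := ⟨(u 1).toNat, by omega⟩
      set u₀ := (fun w : Site 2 => w - Pi.single 1 1)^[k] u with hu₀def
      have hu₀ : u₀ = u - (k : ℤ) • Pi.single 1 1 := iterate_sub_single_one u k
      have hu₀0 : u₀ 0 = u 0 := by rw [hu₀]; simp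
      have hu₀1 : u₀ 1 = 0 := by rw [hu₀]; simp; omega
      have hmove : ∀ (p : zdStarGraph.Walk xL xR), (∀ z ∈ p.support, ¬ (z 0 = u 0 ∧ 0 ≤ z 1 ∧ z 1 ≤ u 1)) →
          starWinding p u = starWinding p u₀ := by
        intro p hp
        refine starWinding_eq_of_latticeWalk p (downRun u k) (fun z hz hzp => ?_) (fun z hz z' hz' hzz' => ?_)
        · rw [mem_support_downRun] at hz
          obtain ⟨hz0, hz1, hz2⟩ := hz
          exact hp z hzp ⟨hz0, by omega, hz2⟩
        · rw [mem_support_downRun] at hz hz'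
          obtain ⟨hz0, hz1, hz2⟩ := hz
          obtain ⟨hz'0, hz'1, hz'2⟩ := hz'
          have : z' 1 = z 1 + 1 := by rw [hzz']; simp
          simp only [mem_rayAbove, hxL1, hxR1]
          constructor <;> rintro ⟨h1, -⟩ <;> omega
      have hα0 : starWinding α u₀ = -1 :=
        starWinding_upperBand_axis hac hcc hcb hxL0 hxR0 hxR1 α hα ⟨by rw [hu₀0]; exact hu.1, by rw [hu₀0]; exact hu.2.1⟩ hu₀1
      have hα'0 : starWinding α' u₀ = 0 :=
        starWinding_lowerBand_axis hcc hxL1 hxR1 α' hα' ⟨by rw [hu₀0]; exact hu.1, by rw [hu₀0]; exact hu.2.1⟩ hu₀1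
      rw [hmove α (fun z hz ⟨h0, h1, h2⟩ => hα z hz ⟨by rw [h0]; exact hu.1, by rw [h0]; exact hu.2.1, by omega⟩),
        hmove α' (fun z hz ⟨h0, h1, h2⟩ => hα' z hz ⟨by rw [h0]; exact hu.1, by rw [h0]; exact hu.2.1, by omega⟩),
        hα0, hα'0]; ring
    · have hm : 1 ≤ m := by
        have := hu.2.2.1; omega
      obtain ⟨k, hk⟩ : ∃ k : ℕ, u 1 = -1 - k := ⟨(-1 - u 1).toNat, by omega⟩
      set u₁ : Site 2 := u + (k : ℤ) • Pi.single 1 1 with hu₁def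
      have hu₁0 : u₁ 0 = u 0 := by simp [hu₁def]
      have hu₁1 : u₁ 1 = -1 := by simp [hu₁def]; omega
      have hend : (fun w : Site 2 => w - Pi.single 1 1)^[k] u₁ = u := by
        rw [iterate_sub_single_one]; simp [hu₁def]
      have hmove : ∀ (p : zdStarGraph.Walk xL xR), (∀ z ∈ p.support, ¬ (z 0 = u 0 ∧ u 1 ≤ z 1 ∧ z 1 ≤ -1)) →
          starWinding p u₁ = starWinding p u := by
        intro p hp
        have h := starWinding_eq_of_latticeWalk p (downRun u₁ k) (fun z hz hzp => ?_) (fun z hz z' hz' hzz' => ?_)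
        · rwa [hend] at h
        · rw [mem_support_downRun] at hz
          obtain ⟨hz0, hz1, hz2⟩ := hz
          exact hp z hzp ⟨by rw [hz0, hu₁0], by omega, by omega⟩
        · rw [mem_support_downRun] at hz hz'
          obtain ⟨hz0, hz1, hz2⟩ := hz
          obtain ⟨hz'0, hz'1, hz'2⟩ := hz'
          have : z' 1 = z 1 + 1 := by rw [hzz']; simp
          simp only [mem_rayAbove, hxL1, hxR1]
          constructor <;> rintro ⟨h1, -⟩ <;> omega
      have hα1 : starWinding α u₁ = 0 :=
        starWinding_upperBand_below hcc hxL1 hxR1 α hα ⟨by rw [hu₁0]; exact hu.1, by rw [hu₁0]; exact hu.2.1⟩ hu₁1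
      have hα'1 : starWinding α' u₁ = 1 :=
        starWinding_lowerBand_below hac hcc hcb hm hxL0 hxR0 hxR1 α' hα' ⟨by rw [hu₁0]; exact hu.1, by rw [hu₁0]; exact hu.2.1⟩ hu₁1
      rw [← hmove α (fun z hz ⟨h0, h1, h2⟩ => hα z hz ⟨by rw [h0]; exact hu.1, by rw [h0]; exact hu.2.1, by omega⟩),
        ← hmove α' (fun z hz ⟨h0, h1, h2⟩ => hα' z hz ⟨by rw [h0]; exact hu.1, by rw [h0]; exact hu.2.1, by omega⟩),
        hα1, hα'1]; ring
  rw [hCu, hw0] at hconst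
  exact absurd hconst (by norm_num)

/-! ### `∗`-escape walks -/

/-- **Refining a `∗`-walk into a lattice walk**: every `∗`-walk can be replaced by a lattice
walk with the same ends each of whose vertices is a vertex of the `∗`-walk or lattice-adjacent to
one (insert a corner into each diagonal step). [folklore] -/
theorem exists_latticeWalk_of_starWalk :
    ∀ {u w : Site 2} (β : zdStarGraph.Walk u w), ∃ β' : (zdGraph 2).Walk u w,
      ∀ v ∈ β'.support, ∃ z ∈ β.support, v = z ∨ (zdGraph 2).Adj v z
  | u, _, Walk.nil => ⟨Walk.nil, fun v hv => ⟨v, hv, Or.inl rfl⟩⟩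
  | u, w, Walk.cons (v := u') hadj β => by
    obtain ⟨β', hβ'⟩ := exists_latticeWalk_of_starWalk β
    have lift : ∀ v ∈ β'.support, ∃ z ∈ (Walk.cons hadj β).support, v = z ∨ (zdGraph 2).Adj v z := by
      intro v hv
      obtain ⟨z, hz, h⟩ := hβ' v hv
      exact ⟨z, by rw [Walk.support_cons]; exact List.mem_cons_of_mem _ hz, h⟩
    by_cases hl : (zdGraph 2).Adj u u'
    · refine ⟨Walk.cons hl β', fun v hv => ?_⟩
      rw [Walk.support_cons, List.mem_cons] at hv
      rcases hv with rfl | hv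
      · exact ⟨v, by simp, Or.inl rfl⟩
      · exact lift v hv
    · -- diagonal step: insert the corner `c = (u'₀, u₁)`
      rw [zdStarGraph_adj] at hadj
      obtain ⟨hne, hclose⟩ := hadj
      have h0 := hclose 0; have h1 := hclose 1
      rw [abs_le] at h0 h1
      rw [zdGraph_adj_iff] at hl
      have hd0 : u' 0 ≠ u 0 := by
        intro h
        have h1' : u' 1 ≠ u 1 := fun h' => hne (by ext i; fin_cases i <;> simp [h, h'])
        rcases lt_or_gt_of_ne h1' with hlt | hgt
        · exact hl ⟨1, Or.inr (by rw [LatticeModels.Site.eq_iff_two]; exact ⟨by simp; omega, by simp; omega⟩)⟩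
        · exact hl ⟨1, Or.inl (by rw [LatticeModels.Site.eq_iff_two]; exact ⟨by simp; omega, by simp; omega⟩)⟩
      have hd1 : u' 1 ≠ u 1 := by
        intro h
        rcases lt_or_gt_of_ne hd0 with hlt | hgt
        · exact hl ⟨0, Or.inr (by rw [LatticeModels.Site.eq_iff_two]; exact ⟨by simp; omega, by simp; omega⟩)⟩
        · exact hl ⟨0, Or.inl (by rw [LatticeModels.Site.eq_iff_two]; exact ⟨by simp; omega, by simp; omega⟩)⟩
      set c : Site 2 := ![u' 0, u 1] with hc
      have huc : (zdGraph 2).Adj u c := by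
        rw [zdGraph_adj_iff]
        rcases lt_or_gt_of_ne hd0 with hlt | hgt
        · exact ⟨0, Or.inr (by rw [LatticeModels.Site.eq_iff_two]; exact ⟨by simp [hc]; omega, by simp [hc]⟩)⟩
        · exact ⟨0, Or.inl (by rw [LatticeModels.Site.eq_iff_two]; exact ⟨by simp [hc]; omega, by simp [hc]⟩)⟩
      have hcu' : (zdGraph 2).Adj c u' := by
        rw [zdGraph_adj_iff]
        rcases lt_or_gt_of_ne hd1 with hlt | hgt
        · exact ⟨1, Or.inr (by rw [LatticeModels.Site.eq_iff_two]; exact ⟨by simp [hc], by simp [hc]; omega⟩)⟩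
        · exact ⟨1, Or.inl (by rw [LatticeModels.Site.eq_iff_two]; exact ⟨by simp [hc], by simp [hc]; omega⟩)⟩
      refine ⟨Walk.cons huc (Walk.cons hcu' β'), fun v hv => ?_⟩
      rw [Walk.support_cons, List.mem_cons, Walk.support_cons, List.mem_cons] at hv
      rcases hv with rfl | rfl | hv
      · exact ⟨v, by simp, Or.inl rfl⟩
      · exact ⟨u, by simp, Or.inr huc.symm⟩
      · exact lift v hv

/-- **The eye lemma for `∗`-escape walks**: in the situation of
`exists_mem_support_of_bandSemicircuits`, a `∗`-walk from the window to far away has a vertex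
equal or lattice-adjacent to a vertex of `α` or `α'` (so that clusters of the escaping walk's
colour and of the semicircuits' colour cannot both be monochromatic unless they touch). [cite: GeorgiiHiguchi2000, Lemma 5.5 (proof)] -/
theorem exists_touch_of_bandSemicircuits {aL bR c₁ c₂ : ℤ} {m : ℕ} (hac : aL < c₁) (hcb : c₂ < bR)
    {xL xR : Site 2} (hxL0 : xL 0 = aL) (hxL1 : xL 1 = 0) (hxR0 : xR 0 = bR) (hxR1 : xR 1 = 0)
    (α : zdStarGraph.Walk xL xR) (hα : ∀ z ∈ α.support, ¬ (c₁ ≤ z 0 ∧ z 0 ≤ c₂ ∧ z 1 ≤ m))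
    (α' : zdStarGraph.Walk xL xR) (hα' : ∀ z ∈ α'.support, ¬ (c₁ ≤ z 0 ∧ z 0 ≤ c₂ ∧ -(m : ℤ) ≤ z 1))
    {H : ℕ} (hH : ∀ z ∈ α.support, z ∈ box 2 H) (hH' : ∀ z ∈ α'.support, z ∈ box 2 H)
    {u w : Site 2} (hu : c₁ ≤ u 0 ∧ u 0 ≤ c₂ ∧ -(m : ℤ) ≤ u 1 ∧ u 1 ≤ m) (hw : w ∉ box 2 H)
    (β : zdStarGraph.Walk u w) :
    ∃ z, (z ∈ α.support ∨ z ∈ α'.support) ∧ ∃ z' ∈ β.support, z = z' ∨ (zdGraph 2).Adj z z' := by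
  obtain ⟨β', hβ'⟩ := exists_latticeWalk_of_starWalk β
  obtain ⟨v, hv, hvC⟩ := exists_mem_support_of_bandSemicircuits hac hcb hxL0 hxL1 hxR0 hxR1 α hα α' hα' hH hH' hu hw β'
  obtain ⟨z', hz', h⟩ := hβ' v hv
  exact ⟨v, hvC, z', hz', h⟩

end Literature.Probability.Percolation
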